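import Literature.MathematicalPhysics.QuantumFieldTheory.Balaban1983to89.B9Thm312WholeHZ

/-!
# `Balaban1983to89.B9Eq3133SlotAHZ` — [B9] (3.133) p. 422 AT «SLOT (a)» THROUGH A COARSE INTERMEDIATE CLASS `bZ` AND A RELATIVE CO-READING: the two sup members of
# (3.133) for `H♭ = G₀Q*(QG₀Q*)⁻¹` (print's n = 0 term of Theorem 3.12's proof) in the currency the N06 certificate of record holds its letters (`B9Thm312WholeHZ.LettersHZ`:
# `gQs2 ∕ dgQs` out of `bZ`, `c2` into `bZ`, `bZ.κ = 1`; `B9CoRealizesHRel.CoRealizesHRel`: output blocks up to a block equivalence)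

T. Bałaban, *Propagators for lattice gauge theories in a background field*, Commun. Math. Phys. **99** (1985) 389–434 [`Balaban1985BackgroundPropagators`, "B9"];
[4] = T. Bałaban, *Propagators and renormalization transformations for lattice gauge theories. II*, Commun. Math. Phys. **96** (1984) 223–250 [`Balaban1984PropagatorsII`].

statement-level skeleton of published theorems with citation tags; proofs where landed; nothing here is a claim about the Yang–Mills mass gap

THE PRINTED LOCI.  As in the sibling `B9Eq3133SlotAH` (p. 420 (3.126), p. 421 (3.130) «G₀ = (Δ + DRD* + Q*aQ)⁻¹», p. 422 (3.132)–(3.133), p. 398 remark; [4] (2.60)–(2.61) p. 234).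

WHY THIS FILE.  `B9Eq3133SlotAH` (this seat, P-H♭ F1) gives the slot-(a) entries with the flat middle class `cNorm … blkZ … 0` and the plain co-reading `CoRealizesH`; the
certificate of record (dag-n06-d's knit heads; this seat's rows-20 pins files) holds the H-letters THROUGH A WEIGHTED MIDDLE CLASS `bZ` (`LettersHZ`, def-Y's (W2) normalisation
of `Q*` and `(QGQ*)⁻¹`, `bZ.κ = 1`) and co-reads its H-kernels RELATIVE to the carrier-block equivalence (`CoRealizesHRel … (RelB i) …`, dag-n06-d ✓`B9CoReadingCoordsH`).  This is
the same n = 0 term in THAT currency — so P-H♭ F3 (the record theorem) composes it with the pins by name.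
* §1 ★ `Hflat_entry0Z` ∕ ★ `Hflat_entry1Z` — `G₀Q*∘C♭ : Z² → 𝔠⁽²⁾`, `∇_UG₀Q*∘C♭ : Z² → 𝔠_Y⁽¹⁾` through `bZ` (`bZ.κ = 1`), majorant `B₃²c·e^{−ρd}`; one `hasMaj_comp_exp` each.
* §2 ★★ `ineq3133flat_sup_of_lettersZ_rel` — the SUP CONJUNCT of `B9.Ineq3133 d Hk (B₃²cΛ) · (2(1−α)ρ) U` from the three letters through `bZ`, the two RELATIVE co-readings
  (`Rel` compatible with `dist` and `len`) and `ScaleTransfer` (this seat's ✓`B9CoRealizesHRel.hk_e0∕e1_of_hasMaj_rel` + ✓`B9Thm312WholeH.ineq3133_sup_of_entries`).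
HONEST SCOPE.  Hypotheses of printed∕definitional shape; nothing of print asserted; Hölder member not treated; count-neutral; NOT a node discharge; nothing continuum, nothing about
the mass gap.  Cell `pub-ymgap` (HUMAN RULING D-0062), Track A node N06 [B9] ∕ K0ᴬ junction (ℓa-H)+(KL-H) ⇐ slot (a) (node00-def-Y g39 (J1)); seat `pub-ymgap-dag-n06-l` (g42),
2026-08-31.  NEW file (sibling of `B9Eq3133SlotAH`); nothing landed is modified.
-/

namespace Literature.MathematicalPhysics.QuantumFieldTheory.Balaban1983to89.B9Eq3133SlotAHZ

open Literature.MathematicalPhysics.QuantumFieldTheory.Balaban1983to89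
open B6RandomWalk B9Thm34Ext B11SectG B9FromB6 B9FromB6ModelSignsOn B9Thm312Whole B9Thm312WholeH B9CoRealizesHRel

noncomputable section

variable {g : B9.Geometry} {B : B9.Backgrounds} {X Y Z : Type}
variable [Fintype X] [Fintype Y] [Fintype Z] [Fintype g.Site]
variable {R₀ : ℝ} {H₀ : Prop}

/-! ## §1 The two step-free entries of `H♭ = G₀Q*C♭` through `bZ` -/

omit [Fintype Y] in
/-- ★ **`H♭ = G₀Q*∘C♭ : Z² → 𝔠⁽²⁾` THROUGH `bZ`**: `G₀Q* : bZ → 𝔠⁽²⁾` (`B₃e^{−δ₃d}`) after `C♭ = (QG₀Q*)⁻¹ : Z² → bZ` (`B₃e^{−δ₃d}`), `bZ.κ = 1`, has the majorant `B₃²c·e^{−ρd}`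
(`ρ + σ ≤ δ₃`, `c` the (2.61) constant at rate `σ ≥ 0`). [cite: Balaban1985BackgroundPropagators, (3.126) p.420 + (3.130) p.421 + (3.132) p.422; Balaban1984PropagatorsII, Lemma 2.1 (2.61) p.234] -/
theorem Hflat_entry0Z (hG : GeoOK g) {blk : X → g.Site} {blkZ : Z → g.Site} {bZ : BlockNorm (toB6 g R₀ H₀) (Z → ℝ)} {G0 : Module.End ℝ (X → ℝ)}
    {Qs : (Z → ℝ) →ₗ[ℝ] (X → ℝ)} {Cop : Module.End ℝ (Z → ℝ)} {B₃ δ₃ ρ σ c : ℝ} (hrow : RowSum (toB6 g R₀ H₀) σ c) (hκ : bZ.κ = 1)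
    (hB₃ : 0 ≤ B₃) (hσ : 0 ≤ σ) (hρ : 0 ≤ ρ) (hρ₃ : ρ + σ ≤ δ₃)
    (hQs : HasMaj bZ (cNorm R₀ H₀ blk hG.lenle 2) (G0 ∘ₗ Qs) (fun a b => B₃ * Real.exp (-(δ₃ * g.dist a b))))
    (hCop : HasMaj (cNorm R₀ H₀ blkZ hG.lenle 2) bZ Cop (fun a b => B₃ * Real.exp (-(δ₃ * g.dist a b)))) :
    HasMaj (cNorm R₀ H₀ blkZ hG.lenle 2) (cNorm R₀ H₀ blk hG.lenle 2) (G0 ∘ₗ (Qs ∘ₗ Cop))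
      (fun a b => B₃ * B₃ * c * Real.exp (-(ρ * g.dist a b))) := by
  have htri : Triangle254 (toB6 g R₀ H₀) := fun a b c => hG.tri a b c
  have hS : HasMaj (cNorm R₀ H₀ blkZ hG.lenle 2) (cNorm R₀ H₀ blk hG.lenle 2) (G0 ∘ₗ (Qs ∘ₗ Cop))
      (fun a b => bZ.κ * B₃ * B₃ * c * Real.exp (-(ρ * g.dist a b))) :=
    hasMaj_comp_exp htri hG.dnn hrow hB₃ hB₃ hρ (by linarith) hρ₃ hQs hCop
  rw [hκ] at hS
  simpa only [one_mul] using hS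

omit [Fintype X] in
/-- ★ **`∇_UH♭ = ∇_UG₀Q*∘C♭ : Z² → 𝔠_Y⁽¹⁾` THROUGH `bZ`** (no `(∇_UG₀Δ′_π)(H)` term at slot (a)). [cite: Balaban1985BackgroundPropagators, (3.133) p.422 + (3.126) p.420 + (3.130) p.421; Balaban1984PropagatorsII, Lemma 2.1 (2.61) p.234] -/
theorem Hflat_entry1Z (hG : GeoOK g) {blkY : Y → g.Site} {blkZ : Z → g.Site} {bZ : BlockNorm (toB6 g R₀ H₀) (Z → ℝ)} {G0 : Module.End ℝ (X → ℝ)}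
    {Dop : (X → ℝ) →ₗ[ℝ] (Y → ℝ)} {Qs : (Z → ℝ) →ₗ[ℝ] (X → ℝ)} {Cop : Module.End ℝ (Z → ℝ)} {B₃ δ₃ ρ σ c : ℝ}
    (hrow : RowSum (toB6 g R₀ H₀) σ c) (hκ : bZ.κ = 1) (hB₃ : 0 ≤ B₃) (hσ : 0 ≤ σ) (hρ : 0 ≤ ρ) (hρ₃ : ρ + σ ≤ δ₃)
    (hDQs : HasMaj bZ (cNorm R₀ H₀ blkY hG.lenle 1) (Dop ∘ₗ G0 ∘ₗ Qs) (fun a b => B₃ * Real.exp (-(δ₃ * g.dist a b))))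
    (hCop : HasMaj (cNorm R₀ H₀ blkZ hG.lenle 2) bZ Cop (fun a b => B₃ * Real.exp (-(δ₃ * g.dist a b)))) :
    HasMaj (cNorm R₀ H₀ blkZ hG.lenle 2) (cNorm R₀ H₀ blkY hG.lenle 1) (Dop ∘ₗ G0 ∘ₗ (Qs ∘ₗ Cop))
      (fun a b => B₃ * B₃ * c * Real.exp (-(ρ * g.dist a b))) := by
  have htri : Triangle254 (toB6 g R₀ H₀) := fun a b c => hG.tri a b c
  have hS : HasMaj (cNorm R₀ H₀ blkZ hG.lenle 2) (cNorm R₀ H₀ blkY hG.lenle 1) ((Dop ∘ₗ G0 ∘ₗ Qs) ∘ₗ Cop)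
      (fun a b => bZ.κ * B₃ * B₃ * c * Real.exp (-(ρ * g.dist a b))) :=
    hasMaj_comp_exp htri hG.dnn hrow hB₃ hB₃ hρ (by linarith) hρ₃ hDQs hCop
  rw [hκ] at hS
  simp only [one_mul] at hS
  exact hS.congr fun b => rfl

/-! ## §2 The sup conjunct of (3.133) for `H♭` through `bZ`, relative co-reading -/

/-- ★★ **(3.133) AT SLOT (a), THE TWO SUP MEMBERS, THROUGH `bZ`, RELATIVE CO-READING**: if the H-kernel `Hk` is co-read at `U`, relative to a block equivalence `Rel` compatible
with `dist` and `len`, by `H♭ = G₀Q*C♭` (n = 0) and `∇_UH♭ = ∇_UG₀Q*C♭` (n = 1), and the letters `gQs2 ∕ dgQs` (out of `bZ`) and `c2♭` (into `bZ`, `bZ.κ = 1`) hold, with [4] (2.61)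
at rate `σ` (constant `c`) and the class transfer at rate `αρ` (constant `Λ`), THEN `Hk.e n U y y′ ≤ (B₃²cΛ)·(Lʲη)^{−n}(L^{j′}η)^{−d}e^{−(δ₁∕2)d(y,y′)}` with `δ₁ = 2(1−α)ρ` — the
sup conjunct of `B9.Ineq3133 d Hk (B₃²cΛ) · δ₁ U` verbatim. [cite: Balaban1985BackgroundPropagators, (3.133) p.422 + (3.126) p.420 + (3.130)–(3.132) pp.421–422 + p.398; Balaban1984PropagatorsII, (2.60)–(2.61) p.234] -/
theorem ineq3133flat_sup_of_lettersZ_rel (hG : GeoOK g) {Hk : B9.HKernel g B} {U : B.Cfg} {d : ℕ} {Rel : g.Site → g.Site → Prop}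
    {blk : X → g.Site} {blkY : Y → g.Site} {blkZ : Z → g.Site} {bZ : BlockNorm (toB6 g R₀ H₀) (Z → ℝ)} {G0 : Module.End ℝ (X → ℝ)}
    {Dop : (X → ℝ) →ₗ[ℝ] (Y → ℝ)} {Qs : (Z → ℝ) →ₗ[ℝ] (X → ℝ)} {Cop : Module.End ℝ (Z → ℝ)} {B₃ δ₃ ρ σ c α Λ : ℝ}
    (hrow : RowSum (toB6 g R₀ H₀) σ c) (hκ : bZ.κ = 1) (hB₃ : 0 ≤ B₃) (hσ : 0 ≤ σ) (hρ : 0 ≤ ρ) (hρ₃ : ρ + σ ≤ δ₃) (hc : 0 ≤ c) (hΛ : 0 ≤ Λ)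
    (hRdist : ∀ a a' b, Rel a a' → g.dist a b = g.dist a' b) (hRlen : ∀ a a', Rel a a' → g.len a = g.len a')
    (hQs : HasMaj bZ (cNorm R₀ H₀ blk hG.lenle 2) (G0 ∘ₗ Qs) (fun a b => B₃ * Real.exp (-(δ₃ * g.dist a b))))
    (hDQs : HasMaj bZ (cNorm R₀ H₀ blkY hG.lenle 1) (Dop ∘ₗ G0 ∘ₗ Qs) (fun a b => B₃ * Real.exp (-(δ₃ * g.dist a b))))
    (hCop : HasMaj (cNorm R₀ H₀ blkZ hG.lenle 2) bZ Cop (fun a b => B₃ * Real.exp (-(δ₃ * g.dist a b))))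
    (hC0 : CoRealizesHRel Hk 0 U d Rel blk blkZ (G0 ∘ₗ (Qs ∘ₗ Cop))) (hC1 : CoRealizesHRel Hk 1 U d Rel blkY blkZ (Dop ∘ₗ G0 ∘ₗ (Qs ∘ₗ Cop)))
    (hST : B9Ineq347.ScaleTransfer g ρ α Λ (fun y => g.len y ^ (2 : ℝ))) :
    ∀ (n : Fin 2) (y y' : g.Site),
      Hk.e n U y y' ≤ (B₃ * B₃ * c * Λ) * (g.len y) ^ (-(n : ℝ)) * (g.len y') ^ (-(d : ℝ)) * Real.exp (-((2 * ((1 - α) * ρ)) / 2 * g.dist y y')) := by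
  have hK0 : 0 ≤ B₃ * B₃ * c := mul_nonneg (mul_nonneg hB₃ hB₃) hc
  have h0 := hk_e0_of_hasMaj_rel hG hK0 hΛ hC0 hRdist hST (Hflat_entry0Z hG hrow hκ hB₃ hσ hρ hρ₃ hQs hCop)
  have h1 := hk_e1_of_hasMaj_rel hG hK0 hΛ hC1 hRdist hRlen hST (Hflat_entry1Z hG hrow hκ hB₃ hσ hρ hρ₃ hDQs hCop)
  refine ineq3133_sup_of_entries hG.lenpos (C₀ := B₃ * B₃ * c * Λ) (C₁ := B₃ * B₃ * c * Λ) le_rfl le_rfl (τ := (1 - α) * ρ)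
    (fun y y' => ?_) (fun y y' => ?_)
  · simpa only [mul_assoc] using h0 y y'
  · simpa only [mul_assoc] using h1 y y'

end

end Literature.MathematicalPhysics.QuantumFieldTheory.Balaban1983to89.B9Eq3133SlotAHZ
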